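import Summits.CriticalPhenomena.PercolationContinuityZ3.Theorems.Transplant.Slab111HubPlan
import HarnessLib

/-!
# The HUB ROUTING of the `(111)`-films, VI: the `HubData` and the SWAP PAIR of a hub plan (`HubPlan.swap`)

builds on p205010 (kernel theorem, internal audit signed; external expert review pending) — NOT used in this file.  Lane `prim-bschramm`, seat
`prim-bschramm-p2` (gen 36; class C1b; memo `HOME/bschramm/P2-LATTICES.md` §130); helper file (`--supports stmt-CriticalPhenomena-4575 --as helper`).
From a `HubPlan` («Slab111HubPlan»: a dispatcher entry — three faces, relative legs — instantiated at a configuration with a hub zone, plus the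
column-or-level side conditions) the `HubData` of «Slab111HubData» (**`HubPlan.toHubData`**: legs realised as film paths, windows from bulk membership
of the region columns, `Clear` conditions from the separations) and the swap pair (**`HubPlan.swap`**, via «Slab111HubRoute2».`hub_gml`).
[cite: DuminilCopinSidoraviciusTassion2016, §2.3 (proof of Fact 2: the three disjoint paths γ_u, γ_v, γ_w in B_R(z))]
-/

noncomputable section

namespace Summit.CriticalPhenomena.PercolationContinuityZ3.Theorems.Transplant

open Literature.Probability.Percolation Literature.Probability.LatticeModels SimpleGraph
open scoped Classical

namespace Slab111

namespace HubPlan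

variable {k : ℕ} {h : Site 2} {c0 : ℤ} {W PR : Set (slab111 k)} {E₁ E₂ w' : slab111 k} (P : HubPlan k h c0 W PR E₁ E₂ w')

/-- Bulk membership of a ride vertex of a face over region columns. [folklore] -/
theorem ride_mem {F : FaceD} (hF : F.ok) {S : Set (slab111 k)} {C : List (ℤ × ℤ)} (hFC : F.f0 ∈ C ∧ F.f1 ∈ C ∧ F.f2 ∈ C)
    (hC : ∀ q ∈ C, ∀ L : ℤ, 1 ≤ L → L ≤ (k : ℤ) - 1 → (3 : ℤ) ∣ L - c0 - (q.1 + 2 * q.2) → vl k (vcol h q) L ∈ S) {L : ℤ} (h1 : 1 ≤ L)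
    (hk : L ≤ (k : ℤ) - 1) : rideV k h c0 F L ∈ S := by
  unfold rideV
  have hmem : colAt F (L - c0) ∈ C := by
    rcases colAt_mem F (L - c0) with e | e | e <;> rw [e]
    · exact hFC.1
    · exact hFC.2.1
    · exact hFC.2.2
  refine hC _ hmem L h1 hk ?_
  have := dvd_colAt hF (L - c0)
  have e : L - c0 - ((colAt F (L - c0)).1 + 2 * (colAt F (L - c0)).2) = -((colAt F (L - c0)).1 + 2 * (colAt F (L - c0)).2 - (L - c0)) := by ring
  rw [e]; exact dvd_neg.2 this

/-- **The `HubData` of a hub plan.** [cite: DuminilCopinSidoraviciusTassion2016, §2.3 (proof of Fact 2: γ_u, γ_v, γ_w)] -/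
def toHubData : HubData k h c0 W PR E₁ E₂ w' where
  F1 := P.F1
  F2 := P.F2
  F3 := P.F3
  d₁ := P.d₁
  d₂ := P.d₂
  d₃ := P.d₃
  LA := P.LA
  LD := P.LD
  τ := P.τ
  ℓ₁ := P.ℓ₁
  ℓ₂ := P.ℓ₂
  ℓ₃ := P.ℓ₃
  m₁ := (P.τ * (P.LA + P.d₁ - P.ℓ₁)).toNat
  leg₁ := legV k h P.q₁ P.n₁ P.l₁
  leg₂ := (legV k h P.q₂ P.n₂ P.l₂).reverse
  leg₃ := (legV k h P.q₃ P.n₃ P.l₃).reverse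
  hz := P.hz
  hPRW := P.hPRW
  hF1 := P.hF1
  hF2 := P.hF2
  hF3 := P.hF3
  ho1 := P.ho1
  ho2 := P.ho2
  ho3 := P.ho3
  h12 := P.h12
  h13 := P.h13
  h23 := P.h23
  hA1 := P.hA1
  hA2 := P.hA2
  hA3 := P.hA3
  hτ := P.hτ
  hLD := P.hLD
  hLA := P.hLA
  hLA1 := by have := P.hLA2; omega
  hLAk := by have := P.hLAk; omega
  hLD1 := by have := P.hLD2; omega
  hLDk := by have := P.hLDk; omega
  hne := P.hne
  hℓ₁ := by have := P.rng1 _ (List.getLast_mem P.hl1.1); exact this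
  hℓ₂ := by have := P.rng2 _ (List.getLast_mem P.hl2.1); exact this
  hℓ₃ := by have := P.rng3 _ (List.getLast_mem P.hl3.1); exact this
  hm₁ := by
    have hs := P.hside
    rw [Int.toNat_of_nonneg (by unfold ℓ₁; exact hs)]
    rcases P.hτ with e | e <;> rw [e] <;> ring
  hW1 := by
    intro L hlo hhi
    by_cases hL : 1 ≤ L ∧ L ≤ (k : ℤ) - 1
    · exact ride_mem P.hF1 P.hF1P P.hPc hL.1 hL.2
    · -- then L = ℓ₁ ∈ {0, k} and the ride vertex is e₁ = E₁ (leg of length 0)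
      have hr := P.rng1 _ (List.getLast_mem P.hl1.1)
      have h2 := P.hLA2; have h3 := P.hLAk; have h4 := P.hLD2; have h5 := P.hLDk
      have hL' : L = P.ℓ₁ ∧ (P.ℓ₁ = 0 ∨ P.ℓ₁ = k) := by unfold ℓ₁ at *; omega
      obtain ⟨rfl, h0k⟩ := hL'
      rw [← P.last1_eq]
      -- the last vertex is at level 0 or k, hence it is the terminal itself (all other leg vertices are at levels in [1,k-1])
      have hlast : P.l₁.getLast P.hl1.1 = ((0, 0), 0) := by
        by_contra hne
        have := P.hc1 _ (List.getLast_mem _) hne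
        unfold ℓ₁ at h0k; omega
      rw [hlast, absV_zero, ← P.E1_eq]; exact P.hE1P
  hW2 := by
    intro L hlo hhi
    by_cases hL : 1 ≤ L ∧ L ≤ (k : ℤ) - 1
    · exact ride_mem P.hF2 P.hF2P P.hPc hL.1 hL.2
    · have hr := P.rng2 _ (List.getLast_mem P.hl2.1)
      have h2 := P.hLA2; have h3 := P.hLAk; have h4 := P.hLD2; have h5 := P.hLDk
      have hL' : L = P.ℓ₂ ∧ (P.ℓ₂ = 0 ∨ P.ℓ₂ = k) := by unfold ℓ₂ at *; omega
      obtain ⟨rfl, h0k⟩ := hL'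
      rw [← P.last2_eq]
      have hlast : P.l₂.getLast P.hl2.1 = ((0, 0), 0) := by
        by_contra hne
        have := P.hc2 _ (List.getLast_mem _) hne
        unfold ℓ₂ at h0k; omega
      rw [hlast, absV_zero, ← P.E2_eq]; exact P.hE2P
  hW3 := by
    intro L hlo hhi
    by_cases hL : 1 ≤ L ∧ L ≤ (k : ℤ) - 1
    · exact ride_mem P.hF3 P.hF3W P.hWc hL.1 hL.2
    · have hr := P.rng3 _ (List.getLast_mem P.hl3.1)
      have h2 := P.hLA2; have h3 := P.hLAk; have h4 := P.hLD2; have h5 := P.hLDk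
      have hL' : L = P.ℓ₃ ∧ (P.ℓ₃ = 0 ∨ P.ℓ₃ = k) := by unfold ℓ₃ at *; omega
      obtain ⟨rfl, h0k⟩ := hL'
      rw [← P.last3_eq]
      have hlast : P.l₃.getLast P.hl3.1 = ((0, 0), 0) := by
        by_contra hne
        have := P.hc3 _ (List.getLast_mem _) hne
        unfold ℓ₃ at h0k; omega
      rw [hlast, absV_zero, ← P.E3_eq]; exact P.hE3W
  hHA := by
    have := P.hPc (0, 0) ?_ P.LA (by have := P.hLA2; omega) (by have := P.hLAk; omega) (by simpa using P.hLA)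
    · have e : vcol h ((0 : ℤ), (0 : ℤ)) = h := by ext i; fin_cases i <;> simp [vcol]
      rw [e] at this; exact this
    · exact P.hub_mem
  hHD := by
    have := P.hPc (0, 0) P.hub_mem P.LD (by have := P.hLD2; omega) (by have := P.hLDk; omega) (by
      have : P.LD - c0 - ((0 : ℤ) + 2 * 0) = (P.LA - c0) + 3 * P.τ := by rw [P.hLD]; ring
      rw [this]; exact dvd_add P.hLA (dvd_mul_right 3 _))
    have e : vcol h ((0 : ℤ), (0 : ℤ)) = h := by ext i; fin_cases i <;> simp [vcol]
    rw [e] at this; exact this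
  hl1 := by
    have g := leg_gpath (k := k) P.hz P.hq1 P.hl1 P.rng1
    rw [← P.E1_eq, P.last1_eq] at g; exact g
  hl2 := by
    have g := (leg_gpath (k := k) P.hz P.hq2 P.hl2 P.rng2).reverse
    rw [← P.E2_eq, P.last2_eq] at g; exact g
  hl3 := by
    have g := (leg_gpath (k := k) P.hz P.hq3 P.hl3 P.rng3).reverse
    rw [← P.E3_eq, P.last3_eq] at g; exact g
  hL1 := by
    intro v hv hve
    obtain ⟨p, hp, rfl⟩ := mem_legV.1 hv
    have hpl : p ≠ P.l₁.getLast P.hl1.1 := fun e => hve (by rw [e, P.last1_eq])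
    obtain ⟨hs, hl⟩ := sh_lev_legV (k := k) P.hz P.hq1 (P.hl1.2.2.2.2 p hp) (P.rng1 p hp).1 (P.rng1 p hp).2
    refine ⟨Or.inl (offCols_of_not_mem (P.ho1' p hp hpl) hs), ?_, ?_, ?_, ?_⟩
    · rcases P.s21 p hp hpl with hc | hlt | hgt
      · exact Or.inl (offCols_of_not_mem hc hs)
      · exact Or.inr (Or.inl (by rw [hl]; exact hlt))
      · exact Or.inr (Or.inr (by rw [hl]; exact hgt))
    · rcases P.s31 p hp hpl with hc | hlt | hgt
      · exact Or.inl (offCols_of_not_mem hc hs)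
      · exact Or.inr (Or.inl (by rw [hl]; exact hlt))
      · exact Or.inr (Or.inr (by rw [hl]; exact hgt))
    · rcases P.hh1 p hp hpl with hc | hlv
      · left; rw [hs]; intro e; exact hc (vcol_injective h e)
      · right; rw [hl]; exact hlv
    · intro hvE
      have hp0 : p ≠ ((0, 0), 0) := by
        rintro rfl; apply hvE
        rw [absV_zero]; exact P.E1_eq.symm
      obtain ⟨hcP, h1, hk1⟩ := P.hc1 p hp hp0
      have := P.hPc _ hcP (P.n₁ + p.2) h1 hk1 ?_
      · rw [(exists_eq_vl (absV k (vcol h P.q₁) P.n₁ p)).2, hs, hl]; exact this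
      · have h2 := P.hl1.2.2.2.2 p hp; unfold RAdm at h2
        have e : P.n₁ + p.2 - c0 - ((P.q₁ + p.1).1 + 2 * (P.q₁ + p.1).2) = (P.n₁ - c0 - (P.q₁.1 + 2 * P.q₁.2)) + (p.2 - (p.1.1 + 2 * p.1.2)) := by
          simp only [Prod.fst_add, Prod.snd_add]; ring
        rw [e]; exact dvd_add P.hq1 h2
  hL2 := by
    intro v hv hve
    rw [List.mem_reverse] at hv
    obtain ⟨p, hp, rfl⟩ := mem_legV.1 hv
    have hpl : p ≠ P.l₂.getLast P.hl2.1 := fun e => hve (by rw [e, P.last2_eq])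
    obtain ⟨hs, hl⟩ := sh_lev_legV (k := k) P.hz P.hq2 (P.hl2.2.2.2.2 p hp) (P.rng2 p hp).1 (P.rng2 p hp).2
    refine ⟨?_, Or.inl (offCols_of_not_mem (P.ho2' p hp hpl) hs), ?_, ?_, ?_⟩
    · rcases P.s12 p hp hpl with hc | hlt | hgt
      · exact Or.inl (offCols_of_not_mem hc hs)
      · exact Or.inr (Or.inl (by rw [hl]; exact hlt))
      · exact Or.inr (Or.inr (by rw [hl]; exact hgt))
    · rcases P.s32 p hp hpl with hc | hlt | hgt
      · exact Or.inl (offCols_of_not_mem hc hs)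
      · exact Or.inr (Or.inl (by rw [hl]; exact hlt))
      · exact Or.inr (Or.inr (by rw [hl]; exact hgt))
    · rcases P.hh2 p hp hpl with hc | hlv
      · left; rw [hs]; intro e; exact hc (vcol_injective h e)
      · right; rw [hl]; exact hlv
    · intro hvE
      have hp0 : p ≠ ((0, 0), 0) := by
        rintro rfl; apply hvE
        rw [absV_zero]; exact P.E2_eq.symm
      obtain ⟨hcP, h1, hk1⟩ := P.hc2 p hp hp0
      have := P.hPc _ hcP (P.n₂ + p.2) h1 hk1 ?_
      · rw [(exists_eq_vl (absV k (vcol h P.q₂) P.n₂ p)).2, hs, hl]; exact this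
      · have h2 := P.hl2.2.2.2.2 p hp; unfold RAdm at h2
        have e : P.n₂ + p.2 - c0 - ((P.q₂ + p.1).1 + 2 * (P.q₂ + p.1).2) = (P.n₂ - c0 - (P.q₂.1 + 2 * P.q₂.2)) + (p.2 - (p.1.1 + 2 * p.1.2)) := by
          simp only [Prod.fst_add, Prod.snd_add]; ring
        rw [e]; exact dvd_add P.hq2 h2
  hL3 := by
    intro v hv hve
    rw [List.mem_reverse] at hv
    obtain ⟨p, hp, rfl⟩ := mem_legV.1 hv
    have hpl : p ≠ P.l₃.getLast P.hl3.1 := fun e => hve (by rw [e, P.last3_eq])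
    obtain ⟨hs, hl⟩ := sh_lev_legV (k := k) P.hz P.hq3 (P.hl3.2.2.2.2 p hp) (P.rng3 p hp).1 (P.rng3 p hp).2
    refine ⟨?_, ?_, Or.inl (offCols_of_not_mem (P.ho3' p hp hpl) hs), ?_, ?_⟩
    · rcases P.s13 p hp hpl with hc | hlt | hgt
      · exact Or.inl (offCols_of_not_mem hc hs)
      · exact Or.inr (Or.inl (by rw [hl]; exact hlt))
      · exact Or.inr (Or.inr (by rw [hl]; exact hgt))
    · rcases P.s23 p hp hpl with hc | hlt | hgt
      · exact Or.inl (offCols_of_not_mem hc hs)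
      · exact Or.inr (Or.inl (by rw [hl]; exact hlt))
      · exact Or.inr (Or.inr (by rw [hl]; exact hgt))
    · rcases P.hh3 p hp hpl with hc | hlv
      · left; rw [hs]; intro e; exact hc (vcol_injective h e)
      · right; rw [hl]; exact hlv
    · by_cases hp0 : p = ((0, 0), 0)
      · subst hp0
        rw [absV_zero, ← P.E3_eq]; exact P.hE3W
      · obtain ⟨hcW, h1, hk1⟩ := P.hc3 p hp hp0
        have := P.hWc _ hcW (P.n₃ + p.2) h1 hk1 ?_
        · rw [(exists_eq_vl (absV k (vcol h P.q₃) P.n₃ p)).2, hs, hl]; exact this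
        · have h2 := P.hl3.2.2.2.2 p hp; unfold RAdm at h2
          have e : P.n₃ + p.2 - c0 - ((P.q₃ + p.1).1 + 2 * (P.q₃ + p.1).2) = (P.n₃ - c0 - (P.q₃.1 + 2 * P.q₃.2)) + (p.2 - (p.1.1 + 2 * p.1.2)) := by
            simp only [Prod.fst_add, Prod.snd_add]; ring
          rw [e]; exact dvd_add P.hq3 h2
  hL12 := by
    intro v hv hve u hu hue heq
    obtain ⟨p, hp, rfl⟩ := mem_legV.1 hv
    rw [List.mem_reverse] at hu
    obtain ⟨p', hp', rfl⟩ := mem_legV.1 hu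
    have hpl : p ≠ P.l₁.getLast P.hl1.1 := fun e => hve (by rw [e, P.last1_eq])
    have hpl' : p' ≠ P.l₂.getLast P.hl2.1 := fun e => hue (by rw [e, P.last2_eq])
    obtain ⟨hs, hl⟩ := sh_lev_legV (k := k) P.hz P.hq1 (P.hl1.2.2.2.2 p hp) (P.rng1 p hp).1 (P.rng1 p hp).2
    obtain ⟨hs', hl'⟩ := sh_lev_legV (k := k) P.hz P.hq2 (P.hl2.2.2.2.2 p' hp') (P.rng2 p' hp').1 (P.rng2 p' hp').2
    apply P.d12 p hp hpl p' hp' hpl'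
    have h1 := congrArg sh heq; rw [hs, hs'] at h1
    have h2 := congrArg (fun x : slab111 k => lev (x : Site 3)) heq; simp only [hl, hl'] at h2
    exact Prod.ext (vcol_injective h h1) h2
  hL13 := by
    intro v hv hve u hu hue heq
    obtain ⟨p, hp, rfl⟩ := mem_legV.1 hv
    rw [List.mem_reverse] at hu
    obtain ⟨p', hp', rfl⟩ := mem_legV.1 hu
    have hpl : p ≠ P.l₁.getLast P.hl1.1 := fun e => hve (by rw [e, P.last1_eq])
    have hpl' : p' ≠ P.l₃.getLast P.hl3.1 := fun e => hue (by rw [e, P.last3_eq])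
    obtain ⟨hs, hl⟩ := sh_lev_legV (k := k) P.hz P.hq1 (P.hl1.2.2.2.2 p hp) (P.rng1 p hp).1 (P.rng1 p hp).2
    obtain ⟨hs', hl'⟩ := sh_lev_legV (k := k) P.hz P.hq3 (P.hl3.2.2.2.2 p' hp') (P.rng3 p' hp').1 (P.rng3 p' hp').2
    apply P.d13 p hp hpl p' hp' hpl'
    have h1 := congrArg sh heq; rw [hs, hs'] at h1
    have h2 := congrArg (fun x : slab111 k => lev (x : Site 3)) heq; simp only [hl, hl'] at h2
    exact Prod.ext (vcol_injective h h1) h2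
  hL23 := by
    intro v hv hve u hu hue heq
    rw [List.mem_reverse] at hv
    obtain ⟨p, hp, rfl⟩ := mem_legV.1 hv
    rw [List.mem_reverse] at hu
    obtain ⟨p', hp', rfl⟩ := mem_legV.1 hu
    have hpl : p ≠ P.l₂.getLast P.hl2.1 := fun e => hve (by rw [e, P.last2_eq])
    have hpl' : p' ≠ P.l₃.getLast P.hl3.1 := fun e => hue (by rw [e, P.last3_eq])
    obtain ⟨hs, hl⟩ := sh_lev_legV (k := k) P.hz P.hq2 (P.hl2.2.2.2.2 p hp) (P.rng2 p hp).1 (P.rng2 p hp).2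
    obtain ⟨hs', hl'⟩ := sh_lev_legV (k := k) P.hz P.hq3 (P.hl3.2.2.2.2 p' hp') (P.rng3 p' hp').1 (P.rng3 p' hp').2
    apply P.d23 p hp hpl p' hp' hpl'
    have h1 := congrArg sh heq; rw [hs, hs'] at h1
    have h2 := congrArg (fun x : slab111 k => lev (x : Site 3)) heq; simp only [hl, hl'] at h2
    exact Prod.ext (vcol_injective h h1) h2

/-- **THE SWAP PAIR OF A HUB PLAN.** [cite: DuminilCopinSidoraviciusTassion2016, §2.3 (proof of Fact 2: the three disjoint paths γ_u, γ_v, γ_w in B_R(z))] -/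
theorem swap (P : HubPlan k h c0 W PR E₁ E₂ w') : ∃ r₁ r₂ : VRouteData (film k) PR W E₁ E₂ w', r₁.y = r₂.b ∧ r₁.b = r₂.y :=
  P.toHubData.hub_gml

end HubPlan

end Slab111

end Summit.CriticalPhenomena.PercolationContinuityZ3.Theorems.Transplant

end
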